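import Summits.ResolutionOfSingularities.ResolutionOfSingularities.Theorems.EquisingularLiftEquisingularLiftNatHyperplaneLetterThroughSection
import Summits.ResolutionOfSingularities.ResolutionOfSingularities.Theorems.EquisingularLiftEquisingularLiftNatCompleteIntersectionLift
import HarnessLib

/-!
# [OURS · L1 W4.5(b) · EL♮(3) · WIDTH TABLE D5 «IMMATURE HOST», supplier row HOPEN, input (IN-1) joint birth, brick (B0)] THE SECTION'S REDUCED COORDINATES
# ARE A ZERO-LOCUS DICTIONARY FOR `x₀` — `KeyForm.section_coords_dictionary` (SIG `L/res-L1-w45b-stub-4/KeyFormSIG.lean` 6e4862d4abec49c6, `letI` form)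

res-L1-w45b-stub-4 g12 (desk R59).  OURS; NOT a statement of any manuscript ([Hironaka2017] is a candidate under adjudication, nothing of it is asserted);
AI-written, weaker than expert review.  No `sorry`; standard axioms; DEF-FREE.  `--supports stmt-ResolutionOfSingularities-20148 --as helper`.

WHAT.  In the EL♮ ambient `ℙⁿ_O = Proj O[x₀..xₙ] → Spec O` (`O` a DVR, `θ : O ↠ k`, `φ = map θ`, `g = Proj φ : ℙⁿ_k → ℙⁿ_O` the special fibre), let `s` be a
section with `s(𝔪) = g x₀`, and let `(i₀, htop, Φ)` be res-type-027's SECTION DATA (✓ `LinearLetter.exists_chart_of_section` / `exists_sectionPull`: the chart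
`D₊(x_{i₀}) ⊇ s(Spec O)` and the coordinate homomorphism `Φ`, with coordinates `a_j = ΓSpecIso (Φ (x_j/x_{i₀}))`).  THEN the reduced coordinates
`ā = θ ∘ a` are a zero-locus dictionary for `x₀`: for every form `G ∈ k[x]_m`, `m > 0`: `G ∈ 𝔭_{x₀} ↔ G(ā) = 0`.
PROOF.  Lift `G` to a form `G̃ ∈ O[x]_m` (✓ `CILift.exists_homogeneous_lift`); `x₀ ∈ V₊(G) = supp (G)~` (✓ `CILift.support_projIdealSheaf_span`) iff
`g x₀ = s(𝔪) ∈ supp (G̃)~` (✓ `CILift.comap_projIdealSheaf_span`: `(G̃)~·𝒪_{ℙ_k} = (G)~`) iff `𝔪 ∈ supp ((G̃)~·𝒪_{Spec O})`, whose ideal of global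
sections is generated by `Φ (G̃/x_{i₀}^m) = ΓSpecIso⁻¹ (G̃(a))` (Literature `projIdealSheaf_ideal_basicOpen_span`, `ideal_comap_of_le`, ✓ `sectionPull_awayMk`),
iff `G̃(a) ∈ 𝔪_O = ker θ` iff `G(θ ∘ a) = 0`. [cite: Hartshorne1977, II Prop. 2.5 and Prop. 5.9] [folklore; pure composition of the cited tree lemmas]
-/

set_option linter.dupNamespace false
set_option linter.overlappingInstances false

noncomputable section

open CategoryTheory CategoryTheory.Limits AlgebraicGeometry TopologicalSpace Opposite IsLocalRing
open MvPolynomial HomogeneousLocalization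
open Literature.AlgebraicGeometry.Resolution
open Literature.AlgebraicGeometry.Motives Literature.AlgebraicGeometry.Motives.Segre Literature.AlgebraicGeometry.Motives.GeneratingSections
open AlgebraicGeometry.Scheme.IdealSheafData

namespace Summit.ResolutionOfSingularities.ResolutionOfSingularities.Cruxes.EquisingularLiftNat.Sections

namespace KeyForm

/-- **(B0) The section's reduced coordinates are a zero-locus dictionary for `x₀`** (see the module docstring). [cite: Hartshorne1977, II Prop. 2.5 and 5.9]
[OURS · L1 W4.5b · (IN-1) brick (B0)] -/
theorem section_coords_dictionary (O : Type) [CommRing O] [IsDomain O] [IsDiscreteValuationRing O] {k : Type} [Field k] (θ : O →+* k)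
    (hθ : Function.Surjective θ) {n : ℕ} :
    letI := MvPolynomial.gradedAlgebra (σ := Fin (n + 1)) (R := O)
    letI := MvPolynomial.gradedAlgebra (σ := Fin (n + 1)) (R := k)
    ∀ (φ : homogeneousSubmodule (Fin (n + 1)) O →+*ᵍ homogeneousSubmodule (Fin (n + 1)) k)
      (hφ' : HomogeneousIdeal.irrelevant (homogeneousSubmodule (Fin (n + 1)) k) ≤ (HomogeneousIdeal.irrelevant (homogeneousSubmodule (Fin (n + 1)) O)).map φ),
      (∀ s, φ s = MvPolynomial.map θ s) →
    ∀ (s : Spec (.of O) ⟶ Proj (homogeneousSubmodule (Fin (n + 1)) O)),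
      s ≫ (Proj.toSpecZero (homogeneousSubmodule (Fin (n + 1)) O) ≫
        Spec.map (CommRingCat.ofHom (algebraMap O ((homogeneousSubmodule (Fin (n + 1)) O) 0)))) = 𝟙 _ →
    ∀ (i₀ : Fin (n + 1)) (htop : (⊤ : (Spec (.of O)).Opens) ≤ preU s i₀)
      (Φ : Away (homogeneousSubmodule (Fin (n + 1)) O) (X i₀) →+* Γ(Spec (.of O), ⊤)),
      (∀ c, s.appLE (Proj.basicOpen (homogeneousSubmodule (Fin (n + 1)) O) (X i₀)) ⊤ htop
        (Proj.awayToSection (homogeneousSubmodule (Fin (n + 1)) O) (X i₀) c) = Φ c) →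
      (∀ c : O, Φ (cst O (X i₀) c) = (Scheme.ΓSpecIso (.of O)).inv c) →
    ∀ (x₀ : Proj (homogeneousSubmodule (Fin (n + 1)) k)), s (IsLocalRing.closedPoint O) = Proj.map φ hφ' x₀ →
    ∀ (m : ℕ), 0 < m → ∀ (G : MvPolynomial (Fin (n + 1)) k), G ∈ homogeneousSubmodule (Fin (n + 1)) k m →
      (G ∈ x₀.asHomogeneousIdeal ↔ MvPolynomial.eval (fun j => θ ((Scheme.ΓSpecIso (.of O)).hom (Φ (frac O i₀ j)))) G = 0) := by
  intro φ hφ' hφ s hs i₀ htop Φ hΦs hΦcst x₀ hsx m hm G hG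
  classical
  letI := MvPolynomial.gradedAlgebra (σ := Fin (n + 1)) (R := O)
  letI := MvPolynomial.gradedAlgebra (σ := Fin (n + 1)) (R := k)
  -- lift the form
  obtain ⟨Gt, hGt, hGtG⟩ := CILift.exists_homogeneous_lift θ hθ G hG
  -- the two ideal sheaves `(G̃)~` on `ℙ_O` and `(G)~` on `ℙ_k`
  set F : Fin 1 → MvPolynomial (Fin (n + 1)) O := fun _ => Gt with hF
  set f : Fin 1 → MvPolynomial (Fin (n + 1)) k := fun _ => G with hf
  have hFm : ∀ l, F l ∈ homogeneousSubmodule (Fin (n + 1)) O ((fun _ => m) l) := fun _ => hGt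
  have hfm : ∀ l, f l ∈ homogeneousSubmodule (Fin (n + 1)) k ((fun _ => m) l) := fun _ => hG
  have hφX : ∀ i : Fin (n + 1), φ (X i) = X i := fun i => by rw [hφ, map_X]
  have hφF : ∀ l, φ (F l) = f l := fun _ => by rw [hφ]; exact hGtG
  set 𝓗 := projIdealSheaf (homogeneousSubmodule (Fin (n + 1)) O)
    ⟨Ideal.span (Set.range F), isHomogeneous_span_of_forall_mem _ F (fun _ => m) hFm⟩ with h𝓗
  -- `x₀ ∈ V₊(G)` iff `s(𝔪) ∈ supp (G̃)~`
  have h1 : G ∈ x₀.asHomogeneousIdeal ↔ s (IsLocalRing.closedPoint O) ∈ (𝓗.support : Set _) := by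
    rw [hsx]
    have h2 : Proj.map φ hφ' x₀ ∈ (𝓗.support : Set _) ↔ x₀ ∈ ((𝓗.comap (Proj.map φ hφ')).support : Set _) := by
      rw [Scheme.IdealSheafData.support_comap]; rfl
    rw [h2, h𝓗, CILift.comap_projIdealSheaf_span φ hφ' hφX F f (fun _ => m) hFm hfm hφF, CILift.support_projIdealSheaf_span f (fun _ => m) hfm]
    simp only [Set.mem_setOf_eq, hf, forall_const]
  -- `s(𝔪) ∈ supp (G̃)~` iff the generator `Φ (G̃/x^m)` of the pulled-back ideal on `Spec O` lies in `𝔪`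
  let V : (Spec (.of O)).affineOpens := ⟨⊤, isAffineOpen_top (Spec (.of O))⟩
  let UO : (Proj (homogeneousSubmodule (Fin (n + 1)) O)).affineOpens :=
    ⟨Proj.basicOpen (homogeneousSubmodule (Fin (n + 1)) O) (X i₀), Proj.isAffineOpen_basicOpen _ (X i₀) (X_mem O i₀) one_pos⟩
  have h3 : s (IsLocalRing.closedPoint O) ∈ (𝓗.support : Set _) ↔
      IsLocalRing.closedPoint O ∈ (Spec (.of O)).zeroLocus (U := (V : (Spec (.of O)).Opens)) (((𝓗.comap s).ideal V : Ideal _) : Set _) := by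
    have h4 : s (IsLocalRing.closedPoint O) ∈ (𝓗.support : Set _) ↔ IsLocalRing.closedPoint O ∈ (𝓗.comap s).support := by
      rw [Scheme.IdealSheafData.support_comap]; rfl
    rw [h4]
    exact Scheme.IdealSheafData.mem_support_iff_of_mem (I := 𝓗.comap s) (U := V) (Set.mem_univ _)
  set r : O := MvPolynomial.eval (fun j => (Scheme.ΓSpecIso (.of O)).hom (Φ (frac O i₀ j))) Gt with hr_def
  have hideal : (𝓗.comap s).ideal V = Ideal.span {(Scheme.ΓSpecIso (.of O)).inv r} := by
    rw [ideal_comap_of_le s 𝓗 UO V htop, h𝓗, projIdealSheaf_ideal_basicOpen_span _ F (fun _ => m) hFm _ (X_mem O i₀), Ideal.map_span,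
      ← Set.range_comp]
    have hr : ((s.appLE (UO : (Proj (homogeneousSubmodule (Fin (n + 1)) O)).Opens) (V : (Spec (.of O)).Opens) htop).hom ∘ fun l : Fin 1 =>
        (Proj.awayToSection (homogeneousSubmodule (Fin (n + 1)) O) (X i₀)).hom (mk₁ (homogeneousSubmodule (Fin (n + 1)) O) (X_mem O i₀) m (F l) (hFm l))) =
        fun _ : Fin 1 => (Scheme.ΓSpecIso (.of O)).inv r := by
      funext l
      simp only [Function.comp_apply]
      change s.appLE _ ⊤ htop (Proj.awayToSection _ (X i₀) _) = _
      rw [hΦs]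
      exact LinearLetter.sectionPull_awayMk i₀ Φ hΦcst m Gt (by simpa using hGt)
    rw [hr, Set.range_const]
  -- the generator lies in `𝔪` iff `G̃(a) ∈ 𝔪_O`
  have h5 : IsLocalRing.closedPoint O ∈ (Spec (.of O)).zeroLocus (U := (V : (Spec (.of O)).Opens)) (((𝓗.comap s).ideal V : Ideal _) : Set _) ↔
      r ∈ IsLocalRing.maximalIdeal O := by
    rw [hideal, Scheme.zeroLocus_span]
    constructor
    · intro hz
      have h := (Scheme.mem_zeroLocus_iff _ _ _).mp hz _ (Set.mem_singleton _)
      rw [basicOpen_eq_of_affine] at h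
      by_contra hne
      exact h hne
    · intro hmem
      refine (Scheme.mem_zeroLocus_iff _ _ _).mpr fun f hf => ?_
      rw [Set.mem_singleton_iff] at hf
      subst hf
      rw [basicOpen_eq_of_affine]
      intro hb
      exact hb hmem
  -- `𝔪_O = ker θ` and `θ (G̃(a)) = G(θ ∘ a)`
  have h6 : θ r = MvPolynomial.eval (fun j => θ ((Scheme.ΓSpecIso (.of O)).hom (Φ (frac O i₀ j)))) G := by
    rw [hr_def, ← hGtG, MvPolynomial.eval_map, show MvPolynomial.eval (fun j => (Scheme.ΓSpecIso (.of O)).hom (Φ (frac O i₀ j))) Gt =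
      eval₂ (RingHom.id O) (fun j => (Scheme.ΓSpecIso (.of O)).hom (Φ (frac O i₀ j))) Gt from rfl,
      eval₂_comp_left θ (RingHom.id O) _ Gt, RingHom.comp_id]
    rfl
  rw [h1, h3, h5, ← LinearLetter.ker_eq_maximalIdeal_of_surjective θ hθ, RingHom.mem_ker, h6]

end KeyForm

end Summit.ResolutionOfSingularities.ResolutionOfSingularities.Cruxes.EquisingularLiftNat.Sections

end
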